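import Mathlib
import Summits.NavierStokesRegularity.NavierStokesRegularity.Theorems.SubOnsagerCeilingSideBranchChainDrive
import Summits.NavierStokesRegularity.NavierStokesRegularity.Theorems.SubOnsagerCeilingSideBranchLiveBalance
import HarnessLib

/-!
# Route SubOnsagerCeiling — ONE CASCADE STEP of the side-branch table `α_SB`: the live block gains at
# least `a²/r·(τ − 1/r)` while the driver is on (helper file for item stmt-NavierStokesRegularity-25507
# `OrthantTailCeiling`; `--supports`; def-free)

Third brick of the ENGINE for the Onsager-critical escape construction (`SideBranchCriticalEscapeEstimateAt`,
negative lemmas p823602 / p823762, positive form p823761): the two bricks of record compose to the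
quantitative core of a Katz–Pavlović-type cascade step.  With
`G_k(u) = −Σ_{j ≤ k} Σ_i ½X_{i,j}(u)² + ½ s_k(u)²` (live-block functional, `sideBranch_liveBlock_*`,
p823858) and along a regular solution of the `ν`-viscous `α_SB` lattice on `[0,s]` (`ν > 0`, no shells
below `0`):

* `sideBranch_liveBlock_gain` — if on a window `[t₀,t₁] ⊆ [0,s]` the driver is on, `Λ_k x_k² ≥ a ≥ 0`,
  the modes `x_{k+1}, s_k` are non-negative and the drains of `x_{k+1}` are small, `x_{k+2}, s_{k+1} ≤ ρ`,
  then `G_k(t₁) − G_k(t₀) ≥ a·(a/r)·((t₁ − t₀) − 1/r)`, `r = (6/5)Λ_{k+1}ρ + ν_{k+1}`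
  (`sideBranch_chain_drive`: `x_{k+1} ≥ (a/r)(1 − e^{−r(t−t₀)})`; `sideBranch_liveBlock_deriv_ge`:
  `G_k' ≥ Λ_k x_k² x_{k+1} ≥ a·x_{k+1}`; `sideBranch_drive_gain`).

USE (the induction this brick serves; not carried out here): with thresholds `δ_j = δ₀(1+ε₀)^{-j}`, if
the energy that has left `x_0..x_{k-1}` is `≥ δ_k` while `E₀ + G_k` stays `< δ_{k+1}` on a window of
length `τ_k ≍ (1+ε₀)^{O(1)}/(Λ_k√δ_k)`, then `a ≍ Λ_k δ_k`, `ρ ≍ √δ_{k+1}` and the gain exceeds `δ_{k+1}` —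
a contradiction — PROVIDED the side unit `(s_{k-1}, z_k)` holds at most `λ·(the rest)` with
`λ < ε₀` (the open SPLIT estimate; numerically `λ ≈ 0.4` at `ε₀ = 1`).  Summing `τ_k` gives a bounded
horizon and `ν ≤ √δ₀` suffices at every depth (rate `1` = Onsager-critical balance `ν_k ≍ Λ_k√δ_k`).

HONEST FRAMING: elementary real analysis of a Tao-type MODEL lattice ODE (route SubOnsagerCeiling, rung
TL-M2Break); a brick toward a construction NOT carried out here; nothing bears on Navier–Stokes
regularity; no crux is settled here. [cite: Tao2016AveragedNS, §4 (4.2)–(4.3)]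
-/

noncomputable section

-- the sub-problem namespace `NavierStokesRegularity.NavierStokesRegularity` is the tree's layout (D-0017)
set_option linter.dupNamespace false

namespace Summit.NavierStokesRegularity.NavierStokesRegularity.Theorems.SubOnsagerCeiling

open Set
open Literature.Analysis.FluidPDE.TaoCascade

section Solution

variable {ε₀ ν s : ℝ} {X : Fin 4 → ℤ → ℝ → ℝ}

/-- **One cascade step: the live block gains while the driver is on.** Along a regular solution of the
`ν`-viscous `α_SB` lattice on `[0,s]` (`ν > 0`, no shells below `0`), let `[t₀,t₁] ⊆ [0,s]` and suppose
on `[t₀,t₁]`: `Λ_k x_k² ≥ a ≥ 0`, `x_{k+1} ≥ 0`, `s_k ≥ 0`, `x_{k+2} ≤ ρ`, `s_{k+1} ≤ ρ` (`ρ ≥ 0`). Then,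
with `r = (6/5)Λ_{k+1}ρ + ν_{k+1}` and `G_k(u) = −Σ_{j ≤ k} Σ_i ½X_{i,j}(u)² + ½X_{1,k}(u)²`,
`a·(a/r)·((t₁ − t₀) − 1/r) ≤ G_k(t₁) − G_k(t₀)`. [this file] -/
theorem sideBranch_liveBlock_gain (hε : 0 < ε₀) (hν : 0 < ν)
    (hlow : ∀ (i : Fin 4) (k : ℤ), k < 0 → ∀ t : ℝ, X i k t = 0)
    (hder : ∀ (i : Fin 4) (k : ℤ), ∀ t ∈ Icc (0 : ℝ) s, HasDerivWithinAt (X i k)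
      (quadTerm ε₀ sideBranchTable X i k t - ν * (1 + ε₀) ^ ((2 : ℝ) * k) * X i k t)
      (Icc (0 : ℝ) s) t)
    (k : ℕ) {t₀ t₁ a ρ : ℝ} (ht₀ : 0 ≤ t₀) (ht : t₀ ≤ t₁) (ht₁ : t₁ ≤ s) (ha : 0 ≤ a) (hρ : 0 ≤ ρ)
    (hx : ∀ u ∈ Icc t₀ t₁, a ≤ (1 + ε₀) ^ ((5 : ℝ) * ((k : ℤ) : ℝ) / 2) * X 0 (k : ℤ) u ^ 2)
    (hy0 : ∀ u ∈ Icc t₀ t₁, 0 ≤ X 0 ((k : ℤ) + 1) u)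
    (hsk : ∀ u ∈ Icc t₀ t₁, 0 ≤ X 1 (k : ℤ) u)
    (hx2 : ∀ u ∈ Icc t₀ t₁, X 0 ((k : ℤ) + 1 + 1) u ≤ ρ)
    (hs1 : ∀ u ∈ Icc t₀ t₁, X 1 ((k : ℤ) + 1) u ≤ ρ) :
    a * (a / ((6 / 5 : ℝ) * (1 + ε₀) ^ ((5 : ℝ) * (((k : ℤ) + 1 : ℤ) : ℝ) / 2) * ρ +
          ν * (1 + ε₀) ^ ((2 : ℝ) * (((k : ℤ) + 1 : ℤ) : ℝ)))) *
        ((t₁ - t₀) - 1 / ((6 / 5 : ℝ) * (1 + ε₀) ^ ((5 : ℝ) * (((k : ℤ) + 1 : ℤ) : ℝ) / 2) * ρ +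
          ν * (1 + ε₀) ^ ((2 : ℝ) * (((k : ℤ) + 1 : ℤ) : ℝ)))) ≤
      (-(∑ j ∈ Finset.range (k + 1), ∑ i : Fin 4, (1 / 2 : ℝ) * X i (j : ℤ) t₁ ^ 2) +
          (1 / 2 : ℝ) * X 1 (k : ℤ) t₁ ^ 2) -
        (-(∑ j ∈ Finset.range (k + 1), ∑ i : Fin 4, (1 / 2 : ℝ) * X i (j : ℤ) t₀ ^ 2) +
          (1 / 2 : ℝ) * X 1 (k : ℤ) t₀ ^ 2) := by
  have hb : (0 : ℝ) < 1 + ε₀ := by linarith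
  set r : ℝ := (6 / 5 : ℝ) * (1 + ε₀) ^ ((5 : ℝ) * (((k : ℤ) + 1 : ℤ) : ℝ) / 2) * ρ +
    ν * (1 + ε₀) ^ ((2 : ℝ) * (((k : ℤ) + 1 : ℤ) : ℝ)) with hrdef
  have hr : 0 < r := by positivity
  have hsub : Icc t₀ t₁ ⊆ Icc (0 : ℝ) s := Icc_subset_Icc ht₀ ht₁
  -- the live-block functional, its derivative within the window, and the chain-flux lower bound
  have hG := fun (u : ℝ) (hu : u ∈ Icc t₀ t₁) =>
    (sideBranch_liveBlock_hasDerivWithinAt hlow hder k (hsub hu)).mono hsub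
  have hG' : ∀ u ∈ Icc t₀ t₁, a * X 0 ((k : ℤ) + 1) u ≤
      botSum ε₀ sideBranchTable X (k : ℤ) u +
        (∑ j ∈ Finset.range (k + 1), ∑ i : Fin 4,
          ν * (1 + ε₀) ^ ((2 : ℝ) * ((j : ℤ) : ℝ)) * X i (j : ℤ) u ^ 2) +
        X 1 (k : ℤ) u * (quadTerm ε₀ sideBranchTable X 1 (k : ℤ) u -
          ν * (1 + ε₀) ^ ((2 : ℝ) * ((k : ℤ) : ℝ)) * X 1 (k : ℤ) u) := by
    intro u hu
    have h1 := sideBranch_liveBlock_deriv_ge (X := X) hε hν.le k (hsk u hu)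
    have h2 : a * X 0 ((k : ℤ) + 1) u ≤
        (1 + ε₀) ^ ((5 : ℝ) * ((k : ℤ) : ℝ) / 2) * X 0 (k : ℤ) u ^ 2 * X 0 ((k : ℤ) + 1) u :=
      mul_le_mul_of_nonneg_right (hx u hu) (hy0 u hu)
    exact h2.trans h1
  -- the drive of `x_{k+1}`
  have hy : ∀ u ∈ Icc t₀ t₁, a / r * (1 - Real.exp (-(r * (u - t₀)))) ≤ X 0 ((k : ℤ) + 1) u :=
    fun u hu => sideBranch_chain_drive hε hν hder (k : ℤ) ht₀ ht₁ hρ hx hy0 hx2 hs1 hu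
  exact sideBranch_drive_gain hr ha (div_nonneg ha hr.le) hG hG' hy ht

end Solution

end Summit.NavierStokesRegularity.NavierStokesRegularity.Theorems.SubOnsagerCeiling

end
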